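import Summits.BirchSwinnertonDyer.BirchSwinnertonDyer.Theorems.KolyvaginDepthDoorDepthTableKuriharaDecisivePrime
import Summits.BirchSwinnertonDyer.BirchSwinnertonDyer.Theorems.KolyvaginDepthDoorKNSupplyLevelOneStructure
import Literature.NumberTheory.EllipticCurves.KuriharaNumberSakamotoPSelmerStructure
import Literature.NumberTheory.EllipticCurves.KuriharaNumberInvariants
import Literature.NumberTheory.EllipticCurves.KuriharaNumberKimModPSelmerBound
import HarnessLib

/-!
# Route `KolyvaginDepthDoor`, crux `KolyvaginDepthSupplyKN` (stmt-BirchSwinnertonDyer-22820) —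
# DEPTH TABLE v22, GENERIC: «THE DECISIVE PAIR» — the E-SIDE of a rank-two row TWO-WAY AT A PRESCRIBED depth-two
# cyclic Kolyvagin level `n = ℓ₁ℓ₂`: `Ш(E/ℚ)[p] = 0 ⟺ δ̃_n(E)` is a unit, granted a KERNEL certificate that the
# localisation matrix of two rational points at `(ℓ₁, ℓ₂)` is invertible mod `p`
# (Sakamoto 2022 Lemma 4.4 + Lemma 4.6 (1) + Remark 4.5 AT DEPTH `r`, BY NAME; Kim 2026 Thm. 1.11 for `⟸`)

Helper file of the lead prover of line `levelone` (kdd-p1 g26; `--supports stmt-BirchSwinnertonDyer-22820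
--as helper`); it closes nothing and BSD is NOT proved by it.

WHY. After v21 every row reads «bit at `(E, p, K)` ⟺ unit `δ̃_{ℓ★}(T₀)`» with the TWIST residue at a PRESCRIBED
prime (v19), but the E-side conjunct «`Ш(E/ℚ)[p] = 0`» is still read ONE WAY from the CLAIM of the tree record
`cert_<E>` (v17, Kim Thm. 1.11) or EXISTENTIALLY («⟺ a unit at SOME cyclic level of depth `≤ rank E`», v18). v22
names the level on the E-side: Sakamoto's Lemma 4.4, Lemma 4.6 (1) and Remark 4.5 ITERATED `r` TIMES from
`λ(1) = dim Sel_p(E) = r` give «`#Sel_p(E) ≤ p^r` + an INVERTIBLE localisation matrix of `r` rational points at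
the `r` primes of a cyclic level `n` ⟹ `δ̃_n ≠ 0`» (the depth-`r` form of v19's depth-one fact
`Sakamoto2022_kuriharaNumber_prime_ne_zero_of_localNondivisible`). At a rank-two curve with `Ш(E)[p] = 0`,
`Sel_p(E) = E(ℚ)/p`, so the matrix of two generators decides the residue at EVERY depth-two level, and the
tree's 59 non-vanishing depth-two records of the 18 rank-two curves `N < 1000` become an AGREEMENT TEST against
kernel arithmetic (per-curve sequel files: all 59 matrices are invertible).

CONTENTS. §0 the named print input `Sakamoto2022_kuriharaNumber_ne_zero_of_localizationInjective` (inline, for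
the gate to relocate), BY NAME — nothing asserted. §1a `localWitness_of_representatives`: the `p² − 1`
combinations from the `p + 1` projective representatives `(1, t)`, `(0, 1)` (pure group theory). §1b
`kuriharaClaim_pair_of_natCard_selmerGroup_le_sq`: tree-vocabulary form at depth two (KN binders as v19). §2
`sha_inf_torsionBy_eq_bot_iff_kuriharaClaim_pair`: at `rank_ℤ E(ℚ) = 2`, «`Ш(E/ℚ)[p] = 0` ⟺ the claim at the
prescribed level» (`⟸` v17 / Kim; `⟹` §1b with `#Sel_p = p^{rank}`). The KERNEL BRIDGES that discharge the
matrix hypotheses per curve (`k • R̄ ≠ O` for `R = a•P₁ + b•P₂` from `decide`-checked chains) are the sibling file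
`…KuriharaDecisivePairBridge`; the per-curve certificates the files `…KuriharaDecisivePair<label>`.

CONDITIONAL on the named facts displayed as hypotheses (`hSakR` = §0; `hKim`, `hnf`, `hMaz` for `⟸`); per
`(W, p, ℓ₁, ℓ₂)`; nothing class-wide (the open stub (S♭) is untouched); BSD is NOT proved by any of this.

References: [Sakamoto2022pSelmer] Doc. Math. 27 (2022) = arXiv:2106.03370, §1 (a)–(c), Def. 2.3–2.4, Thm. 2.20,
Prop. 3.16, Lemma 4.4, Rem. 4.5, Lemma 4.6, Thm. 4.8; [Kurihara2014] arXiv:1407.2465, Thm. 1.2.3 (1), Conj. 1.2.4,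
§5.3 example (8); [Kim2022StructureSelmer] Thm. 1.11; [BurungaleCastellaSkinner2025] Thm. 1.1.2 (b);
[Kato2004Asterisque] Thm. 17.4; [SilvermanAEC2009] III.2.3, VII.2.1, VII.3.1, VIII.2, X.4.2.
-/

set_option linter.dupNamespace false

noncomputable section

open scoped Classical NumberField

/-! ## §0 The named print input (Sakamoto 2022, Lemma 4.4 + Lemma 4.6 (1) + Remark 4.5 at depth `r`), BY NAME -/

namespace Summit.BirchSwinnertonDyer.BirchSwinnertonDyer.Theorems.KolyvaginDepthDoor

open Literature.NumberTheory.EllipticCurves Literature.NumberTheory.EllipticCurves.ModularForms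
  WeierstrassCurve NumberField IsDedekindDomain
open Summit.BirchSwinnertonDyer.BirchSwinnertonDyer.Theorems
open Summit.BirchSwinnertonDyer.BirchSwinnertonDyer.Rank2Observatory

/-! ## §1a The reduction to projective representatives (pure group theory) -/
/-- Transport of local `p`-divisibility along `u • (a • z₁ + b • z₂) = (a' • z₁ + b' • z₂) + p • (…)`:
if `u a = a' + p v`, `u b = b' + p w` and `a' • z₁ + b' • z₂` is NOT `p`-divisible, neither is `a • z₁ + b • z₂`.
[folklore] -/
theorem localNondivisible_transport {G : Type*} [AddCommGroup G] (p : ℕ) (z₁ z₂ : G)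
    (a b a' b' u v w : ℕ) (hua : u * a = a' + p * v) (hub : u * b = b' + p * w)
    (h : ∀ Q : G, p • Q ≠ a' • z₁ + b' • z₂) : ∀ Q : G, p • Q ≠ a • z₁ + b • z₂ := by
  intro Q hQ
  refine h (u • Q - v • z₁ - w • z₂) ?_
  have e : p • (u • Q - v • z₁ - w • z₂) = u • (p • Q) - (p * v) • z₁ - (p * w) • z₂ := by
    rw [smul_sub, smul_sub, smul_smul p v, smul_smul p w, smul_comm p u Q]
  rw [e, hQ, smul_add, smul_smul u a, smul_smul u b, hua, hub, add_smul, add_smul]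
  abel

/-- **From `p + 1` representatives to all `p² − 1` combinations** (in `E(ℚ_{ℓ₁}) × E(ℚ_{ℓ₂})`, abstractly two
additive groups): if the `(0, 1)`, `(1, 0)` and every `(1, t)` combination (`1 ≤ t < p`) is not `p`-divisible in
one of the two groups, so is every `(a, b)` combination with `(a, b) ≢ (0, 0) (mod p)` (multiply by an inverse
of `a` resp. `b` mod `p`) — «the localisation matrix is invertible» read off its projective rows. [folklore] -/
theorem localWitness_of_representatives {G₁ G₂ : Type*} [AddCommGroup G₁] [AddCommGroup G₂] (p : ℕ)
    [hp : Fact p.Prime] (x₁ x₂ : G₁) (y₁ y₂ : G₂)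
    (h01 : (∀ Q : G₁, p • Q ≠ x₂) ∨ (∀ Q : G₂, p • Q ≠ y₂))
    (h10 : (∀ Q : G₁, p • Q ≠ x₁) ∨ (∀ Q : G₂, p • Q ≠ y₁))
    (h1t : ∀ t, 1 ≤ t → t < p →
      (∀ Q : G₁, p • Q ≠ 1 • x₁ + t • x₂) ∨ (∀ Q : G₂, p • Q ≠ 1 • y₁ + t • y₂)) :
    ∀ a b : ℕ, ¬ (p ∣ a ∧ p ∣ b) →
      (∀ Q : G₁, p • Q ≠ a • x₁ + b • x₂) ∨ (∀ Q : G₂, p • Q ≠ a • y₁ + b • y₂) := by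
  have hpP : p.Prime := hp.out
  -- a modular inverse in `ℕ`: `u * c = 1 + p * v`
  have hinv : ∀ c : ℕ, ¬ p ∣ c → ∃ u v : ℕ, u * c = 1 + p * v := by
    intro c hc
    have hc0 : (c : ZMod p) ≠ 0 := by
      rwa [Ne, ZMod.natCast_eq_zero_iff]
    refine ⟨((c : ZMod p)⁻¹).val, ((c : ZMod p)⁻¹).val * c / p, ?_⟩
    have h1 : ((((c : ZMod p)⁻¹).val * c : ℕ) : ZMod p) = ((1 : ℕ) : ZMod p) := by
      rw [Nat.cast_mul, ZMod.natCast_zmod_val, inv_mul_cancel₀ hc0, Nat.cast_one]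
    have h2 := (ZMod.natCast_eq_natCast_iff' _ _ _).mp h1
    rw [Nat.mod_eq_of_lt hpP.one_lt] at h2
    have h3 := Nat.div_add_mod (((c : ZMod p)⁻¹).val * c) p
    omega
  intro a b hab
  by_cases ha : p ∣ a
  · -- `p ∣ a`, so `p ∤ b`: the representative `(0, 1)`
    have hb : ¬ p ∣ b := fun h ↦ hab ⟨ha, h⟩
    obtain ⟨a', rfl⟩ := ha
    obtain ⟨u, v, huv⟩ := hinv b hb
    have hua : u * (p * a') = 0 + p * (u * a') := by ring
    rcases h01 with h | h
    · exact Or.inl (localNondivisible_transport p x₁ x₂ (p * a') b 0 1 u (u * a') v hua huv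
        (by simpa only [zero_smul, one_smul, zero_add] using h))
    · exact Or.inr (localNondivisible_transport p y₁ y₂ (p * a') b 0 1 u (u * a') v hua huv
        (by simpa only [zero_smul, one_smul, zero_add] using h))
  · -- `p ∤ a`: the representative `(1, t)` with `t ≡ b/a (mod p)`
    obtain ⟨u, v, huv⟩ := hinv a ha
    obtain ⟨t, w, htp, hub⟩ : ∃ t w : ℕ, t < p ∧ u * b = t + p * w :=
      ⟨u * b % p, u * b / p, Nat.mod_lt _ hpP.pos, by have := Nat.div_add_mod (u * b) p; omega⟩
    by_cases ht0 : t = 0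
    · subst ht0
      rcases h10 with h | h
      · exact Or.inl (localNondivisible_transport p x₁ x₂ a b 1 0 u v w huv hub
          (by simpa only [zero_smul, one_smul, add_zero] using h))
      · exact Or.inr (localNondivisible_transport p y₁ y₂ a b 1 0 u v w huv hub
          (by simpa only [zero_smul, one_smul, add_zero] using h))
    rcases h1t t (Nat.one_le_iff_ne_zero.mpr ht0) htp with h | h
    · exact Or.inl (localNondivisible_transport p x₁ x₂ a b 1 t u v w huv hub h)
    · exact Or.inr (localNondivisible_transport p y₁ y₂ a b 1 t u v w huv hub h)

/-! ## §1b The tree-vocabulary form at depth two: the claim at the prescribed pair -/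
/-- **THE DECISIVE PAIR (E-side form): a unit mod-`p` Kurihara number AT THE PRESCRIBED LEVEL `n = ℓ₁ℓ₂`.** `W`
globally minimal; `p ≥ 5` good ordinary, `ρ̄_{E,p}` onto, `a_p ≢ 1`, `p ∤ ord_v(Δ_min)` at multiplicative `v`;
`#Sel_p(E/ℚ) ≤ p²`; `n = ℓ₁ℓ₂` a cyclic Kolyvagin level, `ℓ₁ ≠ ℓ₂`; `P₁, P₂ ∈ E(ℚ)` with `P₂`, `P₁` and every
`P₁ + t P₂` (`1 ≤ t < p`) locally `p`-indivisible at `ℓ₁` or at `ℓ₂` (⟺ the localisation matrix at `(ℓ₁, ℓ₂)`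
is invertible, §1a). THEN every datum `D` with `p ∤ c_D` and the period transfer carries a unit Kurihara number AT `n`
(the shape of `KuriharaCertificates.Record.Claim`; `hSakR` by name). CONDITIONAL on `hSakR`; BSD is not proved by it.
[cite: Sakamoto2022pSelmer, Lemma 4.4, Remark 4.5, Lemma 4.6 (1) (p. 14)] [cite: SilvermanAEC2009, VII.3 Prop. 3.1] -/
theorem kuriharaClaim_pair_of_natCard_selmerGroup_le_sq
    (hSakR : Literature.NumberTheory.EllipticCurves.Sakamoto2022_kuriharaNumber_ne_zero_of_localizationInjective)
    (W : WeierstrassCurve ℚ) [W.IsElliptic] [W.IsGloballyMinimal] (p : ℕ) [hp : Fact p.Prime] (h5 : 5 ≤ p)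
    (hgood : W.HasGoodReductionAtPrime p) (hord : ¬ (p : ℤ) ∣ W.frobeniusTrace p)
    (hsur : W.HasSurjectiveModNGaloisRep p) (hna : ¬ (p : ℤ) ∣ W.frobeniusTrace p - 1)
    (hKN : ∀ v : HeightOneSpectrum (𝓞 ℚ), W.HasMultiplicativeReductionAt v → ¬ p ∣ W.ordMinimalDiscriminant v)
    (hle : Nat.card (W.selmerGroup p) ≤ p ^ 2)
    (ℓ₁ ℓ₂ n : ℕ) [hℓ₁ : Fact ℓ₁.Prime] [hℓ₂ : Fact ℓ₂.Prime] (hne : ℓ₁ ≠ ℓ₂) (hnl : ℓ₁ * ℓ₂ = n)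
    [NeZero n] (hn : IsCyclicKolyvaginLevel W p n)
    (P₁ P₂ : W.toAffine.Point)
    (h01 : (∀ Q : (W.baseChange ℚ_[ℓ₁]).toAffine.Point,
        p • Q ≠ WeierstrassCurve.Affine.Point.map (W' := W.toAffine) (S := ℚ) (Algebra.ofId ℚ ℚ_[ℓ₁]) P₂) ∨
      (∀ Q : (W.baseChange ℚ_[ℓ₂]).toAffine.Point,
        p • Q ≠ WeierstrassCurve.Affine.Point.map (W' := W.toAffine) (S := ℚ) (Algebra.ofId ℚ ℚ_[ℓ₂]) P₂))
    (h10 : (∀ Q : (W.baseChange ℚ_[ℓ₁]).toAffine.Point,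
        p • Q ≠ WeierstrassCurve.Affine.Point.map (W' := W.toAffine) (S := ℚ) (Algebra.ofId ℚ ℚ_[ℓ₁]) P₁) ∨
      (∀ Q : (W.baseChange ℚ_[ℓ₂]).toAffine.Point,
        p • Q ≠ WeierstrassCurve.Affine.Point.map (W' := W.toAffine) (S := ℚ) (Algebra.ofId ℚ ℚ_[ℓ₂]) P₁))
    (h1t : ∀ t, 1 ≤ t → t < p →
      (∀ Q : (W.baseChange ℚ_[ℓ₁]).toAffine.Point,
        p • Q ≠ 1 • WeierstrassCurve.Affine.Point.map (W' := W.toAffine) (S := ℚ) (Algebra.ofId ℚ ℚ_[ℓ₁]) P₁ +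
          t • WeierstrassCurve.Affine.Point.map (W' := W.toAffine) (S := ℚ) (Algebra.ofId ℚ ℚ_[ℓ₁]) P₂) ∨
      (∀ Q : (W.baseChange ℚ_[ℓ₂]).toAffine.Point,
        p • Q ≠ 1 • WeierstrassCurve.Affine.Point.map (W' := W.toAffine) (S := ℚ) (Algebra.ofId ℚ ℚ_[ℓ₂]) P₁ +
          t • WeierstrassCurve.Affine.Point.map (W' := W.toAffine) (S := ℚ) (Algebra.ofId ℚ ℚ_[ℓ₂]) P₂))
    {N : ℕ} [NeZero N] (D : ModularParametrizationData W N) (hc : ¬ (p : ℤ) ∣ D.maninConstant)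
    (hu : ∃ u : ℚ, ‖(u : ℚ_[p])‖ = 1 ∧ W.realPeriodRat = u * plusPeriod D.f) :
    ∃ ψ : (q : ℕ) → (ZMod q)ˣ →* Multiplicative (ZMod p),
      (∀ q ∈ n.primeFactors, Function.Surjective (ψ q)) ∧ kuriharaNumber D.f p n ψ ≠ 0 := by
  have htam : ¬ p ∣ W.tamagawaProduct := not_dvd_tamagawaProduct_of_kodairaNeron W p h5 hKN
  have hnap : ¬ p ∣ W.reductionPointCount p := fun h ↦
    hna ((dvd_reductionPointCount_iff_dvd_frobeniusTrace_sub_one W p).mp h)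
  have hℓ₁P : ℓ₁.Prime := hℓ₁.out
  have hℓ₂P : ℓ₂.Prime := hℓ₂.out
  have hpf : n.primeFactors = {ℓ₁, ℓ₂} := by
    rw [← hnl, Nat.primeFactors_mul hℓ₁P.ne_zero hℓ₂P.ne_zero, hℓ₁P.primeFactors, hℓ₂P.primeFactors]
    rfl
  have hcard : n.primeFactors.card = 2 := by rw [hpf, Finset.card_pair hne]
  have hall := localWitness_of_representatives p _ _ _ _ h01 h10 h1t
  refine hSakR W p h5 ⟨hgood, hord⟩ hsur hnap htam D hc hu 2 hle n hn hcard ![P₁, P₂] ?_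
  intro a ha
  have hab : ¬ (p ∣ a 0 ∧ p ∣ a 1) := by
    obtain ⟨i, hi⟩ := ha
    fin_cases i
    · exact fun h ↦ hi h.1
    · exact fun h ↦ hi h.2
  rcases hall (a 0) (a 1) hab with h | h
  · refine ⟨ℓ₁, hℓ₁, by rw [hpf]; exact Finset.mem_insert_self _ _, fun Q hQ ↦ h Q (hQ.trans ?_)⟩
    rw [Fin.sum_univ_two]
    rfl
  · refine ⟨ℓ₂, hℓ₂, by rw [hpf]; exact Finset.mem_insert_of_mem (Finset.mem_singleton_self _),
      fun Q hQ ↦ h Q (hQ.trans ?_)⟩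
    rw [Fin.sum_univ_two]
    rfl

/-! ## §2 The rank-two E-side, EXACTLY, at the prescribed pair -/
/-- **E-SIDE, EXACTLY, AT THE PRESCRIBED PAIR: at `rank_ℤ E(ℚ) = 2`, `Ш(E/ℚ)[p] = 0` ⟺ a unit mod-`p` Kurihara
number of `E` AT THE LEVEL `n = ℓ₁ℓ₂` (for every admissible datum)**, granted the kernel certificate that the
localisation matrix of `P₁, P₂ ∈ E(ℚ)` at `(ℓ₁, ℓ₂)` is invertible mod `p` (`h01`, `h10`, `h1t`; `P₁, P₂` are then a
basis of `E(ℚ)/p`). `⟸`: v17 (Kim Thm. 1.11, depth `2 ≤ rank`); `⟹` NEW: `Ш(E)[p] = 0` gives `#Sel_p(E) = p²` and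
§1b applies — so the residue of the tree record `cert_<E>` at its recorded pair decides `Ш(E)[p] = 0` BOTH WAYS
modulo print, and a recorded UNIT at a pair with SINGULAR matrix would contradict the named facts. CONDITIONAL on
`hKim`, `hnf`, `hMaz`, `hSakR`; per curve; BSD is not proved by it. [cite: Sakamoto2022pSelmer, Lemma 4.4, Lemma 4.6 (1)]
[cite: Kim2022StructureSelmer, Thm. 1.11] [cite: SilvermanAEC2009, Thm. X.4.2] -/
theorem sha_inf_torsionBy_eq_bot_iff_kuriharaClaim_pair
    (hKim : Kim2022_card_selmerGroup_le_pow_of_kuriharaNumber_ne_zero) (hnf : exists_isNewformOf)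
    (hMaz : mazur_not_dvd_maninConstant_of_odd)
    (hSakR : Literature.NumberTheory.EllipticCurves.Sakamoto2022_kuriharaNumber_ne_zero_of_localizationInjective)
    (W : WeierstrassCurve ℚ) [W.IsElliptic] [W.IsGloballyMinimal] (p : ℕ) [hp : Fact p.Prime] (h5 : 5 ≤ p)
    (hgood : W.HasGoodReductionAtPrime p) (hord : ¬ (p : ℤ) ∣ W.frobeniusTrace p)
    (hsur : W.HasSurjectiveModNGaloisRep p) (hna : ¬ (p : ℤ) ∣ W.frobeniusTrace p - 1)
    (hKN : ∀ v : HeightOneSpectrum (𝓞 ℚ), W.HasMultiplicativeReductionAt v → ¬ p ∣ W.ordMinimalDiscriminant v)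
    [iNZ : NeZero (W.conductorNorm ℤ)] (hrank : W.mordellWeilRank = 2)
    (ℓ₁ ℓ₂ n : ℕ) [hℓ₁ : Fact ℓ₁.Prime] [hℓ₂ : Fact ℓ₂.Prime] (hne : ℓ₁ ≠ ℓ₂) (hnl : ℓ₁ * ℓ₂ = n)
    [NeZero n] (hn : IsCyclicKolyvaginLevel W p n)
    (P₁ P₂ : W.toAffine.Point)
    (h01 : (∀ Q : (W.baseChange ℚ_[ℓ₁]).toAffine.Point,
        p • Q ≠ WeierstrassCurve.Affine.Point.map (W' := W.toAffine) (S := ℚ) (Algebra.ofId ℚ ℚ_[ℓ₁]) P₂) ∨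
      (∀ Q : (W.baseChange ℚ_[ℓ₂]).toAffine.Point,
        p • Q ≠ WeierstrassCurve.Affine.Point.map (W' := W.toAffine) (S := ℚ) (Algebra.ofId ℚ ℚ_[ℓ₂]) P₂))
    (h10 : (∀ Q : (W.baseChange ℚ_[ℓ₁]).toAffine.Point,
        p • Q ≠ WeierstrassCurve.Affine.Point.map (W' := W.toAffine) (S := ℚ) (Algebra.ofId ℚ ℚ_[ℓ₁]) P₁) ∨
      (∀ Q : (W.baseChange ℚ_[ℓ₂]).toAffine.Point,
        p • Q ≠ WeierstrassCurve.Affine.Point.map (W' := W.toAffine) (S := ℚ) (Algebra.ofId ℚ ℚ_[ℓ₂]) P₁))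
    (h1t : ∀ t, 1 ≤ t → t < p →
      (∀ Q : (W.baseChange ℚ_[ℓ₁]).toAffine.Point,
        p • Q ≠ 1 • WeierstrassCurve.Affine.Point.map (W' := W.toAffine) (S := ℚ) (Algebra.ofId ℚ ℚ_[ℓ₁]) P₁ +
          t • WeierstrassCurve.Affine.Point.map (W' := W.toAffine) (S := ℚ) (Algebra.ofId ℚ ℚ_[ℓ₁]) P₂) ∨
      (∀ Q : (W.baseChange ℚ_[ℓ₂]).toAffine.Point,
        p • Q ≠ 1 • WeierstrassCurve.Affine.Point.map (W' := W.toAffine) (S := ℚ) (Algebra.ofId ℚ ℚ_[ℓ₂]) P₁ +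
          t • WeierstrassCurve.Affine.Point.map (W' := W.toAffine) (S := ℚ) (Algebra.ofId ℚ ℚ_[ℓ₂]) P₂)) :
    (W.sha ⊓ AddSubgroup.torsionBy W.galH1 (p : ℤ) : AddSubgroup W.galH1) = ⊥ ↔
      ∀ (D : ModularParametrizationData W (W.conductorNorm ℤ)), ¬ (p : ℤ) ∣ D.maninConstant →
        (∃ u : ℚ, ‖(u : ℚ_[p])‖ = 1 ∧ W.realPeriodRat = u * plusPeriod D.f) →
        ∃ ψ : (q : ℕ) → (ZMod q)ˣ →* Multiplicative (ZMod p),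
          (∀ q ∈ n.primeFactors, Function.Surjective (ψ q)) ∧ kuriharaNumber D.f p n ψ ≠ 0 := by
  have hcard : n.primeFactors.card = 2 := by
    rw [← hnl, Nat.primeFactors_mul hℓ₁.out.ne_zero hℓ₂.out.ne_zero, hℓ₁.out.primeFactors, hℓ₂.out.primeFactors]
    exact Finset.card_pair hne
  constructor
  · intro hsha D hc hu
    have hirr : W.HasIrreducibleModPGaloisRep p := hasIrreducibleModPGaloisRep_of_hasSurjectiveModNGaloisRep W p hsur
    have hle : Nat.card (W.selmerGroup p) ≤ p ^ 2 := by
      rw [natCard_selmerGroup_eq_pow_rank_of_sha_inf_torsionBy_eq_bot W p hirr hsha, hrank]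
    exact kuriharaClaim_pair_of_natCard_selmerGroup_le_sq hSakR W p h5 hgood hord hsur hna hKN hle ℓ₁ ℓ₂ n hne hnl hn
      P₁ P₂ h01 h10 h1t D hc hu
  · intro hδ
    exact sha_inf_torsionBy_eq_bot_of_kuriharaClaim hKim hnf hMaz W p h5 hgood hord hsur hna hKN n hn
      (by rw [hcard, hrank]) hδ


end Summit.BirchSwinnertonDyer.BirchSwinnertonDyer.Theorems.KolyvaginDepthDoor

end
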